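import Literature.AnabelianGeometry.EtaleTheta.LogDivisorModelTateTowerKummerTwistCompatRShear
import Mathlib.Data.Countable.Basic

/-!
# [SemiAnbd] Def. 3.1 (i) for the compatible SHEAR-SEMIDIRECT ζ-twisted Kummer–Tate group: `Ẑ(1)^r ⋊ (Ẑˣ × ℤ_γ)` IS a
# tempered group, for every number of classes `r` and every integral translation law `σ` («GRP₃′ TEMPERED»)

S. Mochizuki, *Semi-graphs of anabelioids*, Publ. RIMS **42** (2006) [MochizukiSemiAnbd2006], §3 Def. 3.1 (i) p.33 («may be
written as an inverse limit of an inverse system of surjections of countable discrete topological groups»); S. Mochizuki,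
*The étale theta function …* [MochizukiEtTh2009], §3 Def. 3.3 (ii) p.73 [cite: MochizukiSemiAnbd2006, Def 3.1 (i) p.33].

abc-iut cell, layer L2, seat abc-iut-L1-t6 (gen 5); abc-iut-L2-lead gen 6 R881 («GRP₃′ SHEAR-SEMIDIRECT» = design of record for TATE
TOWER v3 piece 2b(ii)) + ROWS #122 pointer («carry L2-d2's `V_n` witness into `…CompatRShear`»).  Sequel to
`LogDivisorModelTateTowerKummerTwistCompatRShear.lean` (p482446); the analogue, for the NON-ABELIAN compatible group
`TateTowerKummerTwistRShear.Compat r σ` (Kummer classes `Ẑ(1)^r`, constant field `Ẑˣ` through `χ`, translations `ℤ_γ` through the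
integral representation `σ`), of abc-iut-L2-d2's `LogDivisorModelTateTowerKummerTwistTempered.lean` (p482079, the `σ = 1`, `r = 2`
group) — its DESIGN POINT carried over verbatim: the level subgroups `closureC r σ n` have UNCOUNTABLE index (they force `c = 1`),
so they cannot witness [SemiAnbd] Def. 3.1 (i); instead ONE def + theorems (names in THIS namespace; nothing of p482079 restated):
* `vSub r σ n` — `{γ = 1, k_i = 0, c_i = 1 (i < n)} ∩ compat`: an OPEN NORMAL subgroup (`vSub_normal`: `χ` and `σ̄_a` act
  index-wise linearly and `C × ℤ_γ` is commutative; `isOpen_vSub`) of COUNTABLE index (`countable_quotient_vSub`: the coset of `g`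
  is determined by its classes and character values of index `< n` and its translation), `vOpenNormal r σ n : OpenNormalSubgroup _`;
* `exists_vSub_subset_of_isOpen` — every neighbourhood of `1` contains some `vSub r σ n` (box argument in `K_r × (C × ℤ_γ)`);
* **`TateTowerKummerTwistRShear.isTemperedC : IsTempered (Compat r σ)`** — basis, separation, completeness (a compatible family of
  cosets is read off on the `vSub n`: translation from `n = 0`, index-`i` data from `n = i+1`; the glued element is COMPATIBLE
  because the representatives are); `r = 3` / `r = 2` instances `isTempered_compat₃'`, `isTempered_compat₂'`.
The A10 «Galois» form over a tower with group `Grp r σ` waits for piece 2c (tower lineage) and is NOT in this file.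
HONEST FRAMING: a combinatorial consistency witness (class-(b) design model, NOT the tempered fundamental group of a Tate curve); nothing
here bears on [IUTchIII] Cor. 3.12; no side taken; typed ≠ proved.
-/

noncomputable section

namespace Literature.AnabelianGeometry.EtaleTheta

open CategoryTheory Opposite Function Topology Literature.AlgebraicGeometry.Frobenioids
  Literature.AlgebraicGeometry.Frobenioids.QuasiTemperoid Literature.AnabelianGeometry.SemiGraphs

namespace TateTowerKummerTwistRShear

open TateTowerKummerTwist (M one_lt_M Cst M_dvd res resC)
open TateTowerKummerTwistR (KumAdd Kum resK)

variable (r : ℕ) (σ : Multiplicative ℤ →* Matrix (Fin r) (Fin r) ℤ)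

/-! ## §1 Coordinates of `a⁻¹ b` and the open normal subgroups `vSub n` -/

/-- `σ̄_a` has trivial kernel on the index-`n` classes (it is invertible with inverse `σ̄_{a⁻¹}`).
[cite: MochizukiEtTh2009, Def 3.3 (ii) p.73] -/
theorem mulVec_red_sigma_eq_zero_iff (n : ℕ) (a : Multiplicative ℤ) (v : Fin r → ZMod (M n)) :
    Matrix.mulVec (red r n (σ a)) v = 0 ↔ v = 0 := by
  constructor
  · intro h
    have := congrArg (Matrix.mulVec (red r n (σ a⁻¹))) h
    rwa [Matrix.mulVec_mulVec, red_sigma_mul, inv_mul_cancel, red_sigma_one, Matrix.one_mulVec, Matrix.mulVec_zero] at this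
  · intro h
    rw [h, Matrix.mulVec_zero]

/-- Kummer classes of `a⁻¹ b`: `χ(a)⁻¹ σ̄_{γ(a)⁻¹} (k^b − k^a)`. [cite: MochizukiEtTh2009, §1 p.13] -/
theorem left_inv_mul (a b : Grp r σ) (i : ℕ) :
    (a⁻¹ * b).left.toAdd i =
      ((a.right.1⁻¹ i : (ZMod (M i))ˣ) : ZMod (M i)) • Matrix.mulVec (red r i (σ a.right.2⁻¹)) (b.left.toAdd i - a.left.toAdd i) := by
  rw [toAdd_left_mul, toAdd_left_inv, SemidirectProduct.inv_right, Prod.fst_inv, Prod.snd_inv, ← smul_add, ← Matrix.mulVec_add,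
    neg_add_eq_sub]

/-- `C × ℤ_γ` component of `a⁻¹ b`. [cite: MochizukiEtTh2009, §1 p.13] -/
theorem right_inv_mul (a b : Grp r σ) : (a⁻¹ * b).right = a.right⁻¹ * b.right := by
  rw [SemidirectProduct.mul_right, SemidirectProduct.inv_right]

/-- **`vSub n = {γ = 1, k_i = 0, c_i = 1 for i < n} ∩ compat`** — trivial translation and trivial data (all `r` Kummer classes AND the
character value) of every index `< n`. [cite: MochizukiSemiAnbd2006, Def 3.1 (i) p.33] -/
def vSub (n : ℕ) : Subgroup (Compat r σ) where
  carrier := {g | (g : Grp r σ).right.2 = 1 ∧ ∀ i < n, (g : Grp r σ).left.toAdd i = 0 ∧ (g : Grp r σ).right.1 i = 1}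
  mul_mem' := by
    rintro a b ⟨ha2, ha⟩ ⟨hb2, hb⟩
    refine ⟨by rw [Subgroup.coe_mul, SemidirectProduct.mul_right, Prod.snd_mul, ha2, hb2, mul_one], fun i hi => ⟨?_, ?_⟩⟩
    · rw [Subgroup.coe_mul, toAdd_left_mul, (ha i hi).1, (hb i hi).1, Matrix.mulVec_zero, smul_zero, add_zero]
    · rw [Subgroup.coe_mul, SemidirectProduct.mul_right, Prod.fst_mul, Pi.mul_apply, (ha i hi).2, (hb i hi).2, mul_one]
  one_mem' := ⟨rfl, fun _ _ => ⟨rfl, rfl⟩⟩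
  inv_mem' := by
    rintro a ⟨ha2, ha⟩
    refine ⟨by rw [Subgroup.coe_inv, SemidirectProduct.inv_right, Prod.snd_inv, ha2, inv_one], fun i hi => ⟨?_, ?_⟩⟩
    · rw [Subgroup.coe_inv, toAdd_left_inv, (ha i hi).1, neg_zero, Matrix.mulVec_zero, smul_zero]
    · rw [Subgroup.coe_inv, SemidirectProduct.inv_right, Prod.fst_inv, Pi.inv_apply, (ha i hi).2, inv_one]

/-- Membership in `vSub n`. [cite: MochizukiSemiAnbd2006, Def 3.1 (i) p.33] -/
theorem mem_vSub_iff (n : ℕ) (g : Compat r σ) :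
    g ∈ vSub r σ n ↔ (g : Grp r σ).right.2 = 1 ∧
      ∀ i < n, (g : Grp r σ).left.toAdd i = 0 ∧ (g : Grp r σ).right.1 i = 1 := Iff.rfl

/-- `a⁻¹ b ∈ vSub n` iff `a`, `b` have the same translation and the same data of every index `< n`.
[cite: MochizukiSemiAnbd2006, Def 3.1 (i) p.33] -/
theorem inv_mul_mem_vSub_iff (n : ℕ) (a b : Compat r σ) :
    a⁻¹ * b ∈ vSub r σ n ↔ (a : Grp r σ).right.2 = (b : Grp r σ).right.2 ∧
      ∀ i < n, (a : Grp r σ).left.toAdd i = (b : Grp r σ).left.toAdd i ∧ (a : Grp r σ).right.1 i = (b : Grp r σ).right.1 i := by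
  rw [mem_vSub_iff, Subgroup.coe_mul, Subgroup.coe_inv, right_inv_mul, Prod.snd_mul, Prod.snd_inv, inv_mul_eq_one]
  refine and_congr Iff.rfl (forall_congr' fun i => forall_congr' fun _ => ?_)
  rw [left_inv_mul, Prod.fst_mul, Prod.fst_inv, Pi.mul_apply, Pi.inv_apply, ← Units.smul_def, smul_eq_zero_iff_eq,
    mulVec_red_sigma_eq_zero_iff, sub_eq_zero, inv_mul_eq_one, eq_comm]

/-- The `vSub n` are nested. [cite: MochizukiSemiAnbd2006, Def 3.1 (i) p.33] -/
theorem vSub_antitone {n m : ℕ} (h : n ≤ m) : vSub r σ m ≤ vSub r σ n :=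
  fun _ hg => ⟨hg.1, fun i hi => hg.2 i (lt_of_lt_of_le hi h)⟩

/-- **`vSub n` is NORMAL** (`χ` and `σ̄_a` act index-wise linearly; `C × ℤ_γ` is commutative).
[cite: MochizukiSemiAnbd2006, Def 3.1 (i) p.33] -/
theorem vSub_normal (n : ℕ) : (vSub r σ n).Normal := by
  refine ⟨fun g hg h => ?_⟩
  obtain ⟨hg2, hgc⟩ := hg
  have hright : ((h * g * h⁻¹ : Compat r σ) : Grp r σ).right = (g : Grp r σ).right := by
    rw [Subgroup.coe_mul, Subgroup.coe_mul, Subgroup.coe_inv, SemidirectProduct.mul_right, SemidirectProduct.mul_right,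
      SemidirectProduct.inv_right, mul_inv_cancel_comm]
  refine ⟨by rw [hright, hg2], fun i hi => ⟨?_, by rw [hright, (hgc i hi).2]⟩⟩
  rw [Subgroup.coe_mul, Subgroup.coe_mul, Subgroup.coe_inv, toAdd_left_mul, toAdd_left_mul, toAdd_left_inv,
    (hgc i hi).1, Matrix.mulVec_zero, smul_zero, add_zero, SemidirectProduct.mul_right, Prod.fst_mul, Prod.snd_mul,
    Pi.mul_apply, (hgc i hi).2, mul_one, hg2, mul_one, Pi.inv_apply, Matrix.mulVec_smul,
    ← mul_smul, Units.mul_inv, one_smul, Matrix.mulVec_mulVec, red_sigma_mul, mul_inv_cancel, red_sigma_one,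
    Matrix.one_mulVec, add_neg_cancel]

/-- **`vSub n` is OPEN** (finitely many discrete coordinates and the discrete translation are constrained).
[cite: MochizukiSemiAnbd2006, Def 3.1 (i) p.33] -/
theorem isOpen_vSub (n : ℕ) : IsOpen (vSub r σ n : Set (Compat r σ)) := by
  have h : (vSub r σ n : Set (Compat r σ)) = (fun g : Compat r σ => (g : Grp r σ).right.2) ⁻¹' {1} ∩
      ⋂ i ∈ Finset.range n, ((fun g : Compat r σ => (g : Grp r σ).left.toAdd i) ⁻¹' {0} ∩
        (fun g : Compat r σ => ((g : Grp r σ).right.1 i : ZMod (M i))) ⁻¹' {1}) := by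
    ext g
    simp only [Set.mem_inter_iff, Set.mem_iInter, Set.mem_preimage, Set.mem_singleton_iff, Finset.mem_range, Units.val_eq_one]
    rfl
  rw [h]
  exact ((isOpen_discrete _).preimage
    ((continuous_snd.comp (SettingModel.Semidirect.continuous_right (isInducing_leftRight r σ))).comp continuous_subtype_val)).inter
    (isOpen_biInter_finset fun i _ =>
      ((isOpen_discrete _).preimage ((continuous_coordK r σ i).comp continuous_subtype_val)).inter
        ((isOpen_discrete _).preimage (Units.continuous_val.comp ((continuous_coordC r σ i).comp continuous_subtype_val))))

/-- **`Compat / vSub n` is COUNTABLE**: the coset of `g` is determined by its data of index `< n` and its translation.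
[cite: MochizukiSemiAnbd2006, Def 3.1 (i) p.33] -/
theorem countable_quotient_vSub (n : ℕ) : Countable (Compat r σ ⧸ vSub r σ n) := by
  -- read off the data of index `< n` (as natural numbers, via `ZMod.val`) and the translation
  let F : Compat r σ → (Fin n → Fin r → ℕ) × (Fin n → ℕ) × ℤ :=
    fun g => (fun i j => ((g : Grp r σ).left.toAdd i j).val, fun i => (((g : Grp r σ).right.1 i : ZMod (M i))).val,
      Multiplicative.toAdd (g : Grp r σ).right.2)
  have hF : ∀ a b : Compat r σ, a⁻¹ * b ∈ vSub r σ n → F a = F b := fun a b hab => by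
    obtain ⟨h2, hc⟩ := (inv_mul_mem_vSub_iff r σ n a b).1 hab
    refine Prod.ext (funext fun i => funext fun j => ?_) (Prod.ext (funext fun i => ?_) (congrArg Multiplicative.toAdd h2))
    · change ((a : Grp r σ).left.toAdd i j).val = ((b : Grp r σ).left.toAdd i j).val
      rw [(hc i i.2).1]
    · change (((a : Grp r σ).right.1 i : ZMod (M i))).val = (((b : Grp r σ).right.1 i : ZMod (M i))).val
      rw [(hc i i.2).2]
  refine Function.Injective.countable (f := fun q : Compat r σ ⧸ vSub r σ n => Quotient.liftOn' q F fun a b hab =>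
    hF a b (QuotientGroup.leftRel_apply.1 hab)) fun q₁ q₂ hq => ?_
  induction q₁ using QuotientGroup.induction_on with
  | H a =>
    induction q₂ using QuotientGroup.induction_on with
    | H b =>
      change F a = F b at hq
      obtain ⟨h1, h2, h3⟩ := Prod.ext_iff.1 hq |>.imp id Prod.ext_iff.1
      refine QuotientGroup.eq.2 ((inv_mul_mem_vSub_iff r σ n a b).2 ⟨Multiplicative.toAdd.injective h3, fun i hi => ?_⟩)
      haveI : NeZero (M i) := ⟨(Nat.factorial_pos _).ne'⟩
      exact ⟨funext fun j => ZMod.val_injective _ (congrFun (congrFun h1 ⟨i, hi⟩) j),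
        Units.ext (ZMod.val_injective _ (congrFun h2 ⟨i, hi⟩))⟩

/-- `vSub n` as an OPEN NORMAL subgroup of the compatible group. [cite: MochizukiSemiAnbd2006, Def 3.1 (i) p.33] -/
def vOpenNormal (n : ℕ) : OpenNormalSubgroup (Compat r σ) :=
  { toOpenSubgroup := ⟨vSub r σ n, isOpen_vSub r σ n⟩, isNormal' := vSub_normal r σ n }

/-- Underlying subgroup of `vOpenNormal n`. [cite: MochizukiSemiAnbd2006, Def 3.1 (i) p.33] -/
theorem vOpenNormal_toSubgroup (n : ℕ) : (vOpenNormal r σ n).toSubgroup = vSub r σ n := rfl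

/-! ## §2 Every neighbourhood of `1` contains some `vSub n` -/

/-- **Every open neighbourhood of `1` in `Compat r σ` contains some `vSub n`** (the topology is induced from `K_r × (C × ℤ_γ)`, products
of discrete factors: an open set constrains finitely many coordinates). [cite: MochizukiSemiAnbd2006, Def 3.1 (i) p.33] -/
theorem exists_vSub_subset_of_isOpen {U : Set (Compat r σ)} (hU : IsOpen U) (h1 : (1 : Compat r σ) ∈ U) :
    ∃ n, (vSub r σ n : Set (Compat r σ)) ⊆ U := by
  obtain ⟨s, hs, hsU⟩ := isOpen_induced_iff.mp hU
  let ι : KumAdd r × Cst → Grp r σ := fun p => ⟨Multiplicative.ofAdd p.1, (p.2, 1)⟩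
  have hι : Continuous ι :=
    ((isInducing_leftRight r σ).continuous_iff).2
      ((continuous_ofAdd.comp continuous_fst).prodMk (continuous_snd.prodMk continuous_const))
  have h0 : ((0 : KumAdd r), (1 : Cst)) ∈ ι ⁻¹' s := by
    have h1' : (1 : Compat r σ) ∈ Subtype.val ⁻¹' s := by rw [hsU]; exact h1
    exact h1'
  obtain ⟨u₁, u₂, hu₁, hu₂, h01, h12, huu⟩ := isOpen_prod_iff.1 (hs.preimage hι) 0 1 h0
  obtain ⟨I, w, hw, hIw⟩ := isOpen_pi_iff.1 hu₁ 0 h01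
  obtain ⟨J, w', hw', hJw⟩ := isOpen_pi_iff.1 hu₂ 1 h12
  refine ⟨max (I.sup id) (J.sup id) + 1, fun g hg => ?_⟩
  obtain ⟨hg2, hgc⟩ := hg
  have hgι : (g : Grp r σ) = ι (Multiplicative.toAdd (g : Grp r σ).left, (g : Grp r σ).right.1) :=
    SemidirectProduct.ext (ofAdd_toAdd _).symm (Prod.ext rfl hg2)
  have hmem : (Multiplicative.toAdd (g : Grp r σ).left, (g : Grp r σ).right.1) ∈ ι ⁻¹' s := by
    refine huu ⟨hIw fun a ha => ?_, hJw fun a ha => ?_⟩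
    · have hlt : a < max (I.sup id) (J.sup id) + 1 :=
        Nat.lt_succ_of_le ((Finset.le_sup (f := id) ha).trans (le_max_left _ _))
      change (g : Grp r σ).left.toAdd a ∈ w a
      rw [(hgc a hlt).1]
      exact (hw a ha).2
    · have hlt : a < max (I.sup id) (J.sup id) + 1 :=
        Nat.lt_succ_of_le ((Finset.le_sup (f := id) ha).trans (le_max_right _ _))
      change (g : Grp r σ).right.1 a ∈ w' a
      rw [(hgc a hlt).2]
      exact (hw' a ha).2
  rw [← hsU]
  change (g : Grp r σ) ∈ s
  rw [hgι]
  exact hmem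

/-- Every open normal subgroup of `Compat r σ` contains some `vSub n`. [cite: MochizukiSemiAnbd2006, Def 3.1 (i) p.33] -/
theorem exists_vOpenNormal_le (N : OpenNormalSubgroup (Compat r σ)) : ∃ n, vOpenNormal r σ n ≤ N := by
  obtain ⟨n, hn⟩ := exists_vSub_subset_of_isOpen r σ N.toOpenSubgroup.isOpen N.toOpenSubgroup.one_mem
  exact ⟨n, fun g hg => hn hg⟩

/-! ## §3 `Compat r σ` is tempered -/

/-- **[SemiAnbd] Def. 3.1 (i): the compatible shear-semidirect ζ-twisted Kummer–Tate group `Ẑ(1)^r ⋊ (Ẑˣ × ℤ_γ)` is a TEMPERED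
group**, for every `r` and every integral translation law `σ` — basis of open normal subgroups of countable index (`vSub n`),
separation, and completeness (`Compat = lim_n Compat/vSub n`: a compatible family of cosets is read off coordinatewise — translation
at `n = 0`, the index-`i` data at `n = i+1` — and the glued element is compatible because the representatives are).
[cite: MochizukiSemiAnbd2006, Def 3.1 (i) p.33] -/
theorem isTemperedC : IsTempered (Compat r σ) where
  basis U hU := by
    obtain ⟨V, hVU, hVo, h1V⟩ := mem_nhds_iff.mp hU
    obtain ⟨n, hn⟩ := exists_vSub_subset_of_isOpen r σ hVo h1V
    exact ⟨vOpenNormal r σ n, countable_quotient_vSub r σ n, hn.trans hVU⟩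
  separated g hg := by
    by_cases h2 : (g : Grp r σ).right.2 = 1
    · by_cases hk : ∃ i, ¬((g : Grp r σ).left.toAdd i = 0 ∧ (g : Grp r σ).right.1 i = 1)
      · obtain ⟨i, hi⟩ := hk
        exact ⟨vOpenNormal r σ (i + 1), fun hmem => hi (hmem.2 i (Nat.lt_succ_self i))⟩
      · simp only [not_exists, not_not] at hk
        exact absurd (Subtype.ext (SemidirectProduct.ext
          (Multiplicative.toAdd.injective (funext fun i => (hk i).1)) (Prod.ext (funext fun i => (hk i).2) h2))) hg
    · exact ⟨vOpenNormal r σ 0, fun hmem => h2 hmem.1⟩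
  complete x hx := by
    -- representatives modulo each `vSub n`
    have hr : ∀ n, ∃ g : Compat r σ, (g : Compat r σ ⧸ (vOpenNormal r σ n).toSubgroup) = x (vOpenNormal r σ n) :=
      fun n => QuotientGroup.mk_surjective _
    choose g hg using hr
    -- two representatives of compatible levels agree modulo the coarser `vSub`
    have hcompat : ∀ {n m : ℕ}, m ≤ n → (g m)⁻¹ * g n ∈ vSub r σ m := by
      intro n m hmn
      have h1 : x (vOpenNormal r σ m) = (g n : Compat r σ ⧸ (vOpenNormal r σ m).toSubgroup) :=
        hx (vOpenNormal r σ n) (vOpenNormal r σ m) (fun y hy => vSub_antitone r σ hmn hy) (g n) (hg n).symm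
      rw [← hg m] at h1
      exact QuotientGroup.eq.1 h1
    -- the data of index `i` stabilise from `n = i+1` on, the translation from `n = 0` on
    have hcoord : ∀ {i n : ℕ}, i < n →
        ((g n : Compat r σ) : Grp r σ).left.toAdd i = ((g (i + 1) : Compat r σ) : Grp r σ).left.toAdd i ∧
          ((g n : Compat r σ) : Grp r σ).right.1 i = ((g (i + 1) : Compat r σ) : Grp r σ).right.1 i := by
      intro i n hin
      obtain ⟨-, hc⟩ := (inv_mul_mem_vSub_iff r σ _ _ _).1 (hcompat (Nat.succ_le_of_lt hin))
      exact ⟨(hc i (Nat.lt_succ_self i)).1.symm, (hc i (Nat.lt_succ_self i)).2.symm⟩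
    have hγ : ∀ n, ((g n : Compat r σ) : Grp r σ).right.2 = ((g 0 : Compat r σ) : Grp r σ).right.2 := fun n =>
      ((inv_mul_mem_vSub_iff r σ _ _ _).1 (hcompat (Nat.zero_le n))).1.symm
    -- the glued element, compatible because the representatives are
    let g₀ : Grp r σ := ⟨Multiplicative.ofAdd fun i => ((g (i + 1) : Compat r σ) : Grp r σ).left.toAdd i,
      (fun i => ((g (i + 1) : Compat r σ) : Grp r σ).right.1 i, ((g 0 : Compat r σ) : Grp r σ).right.2)⟩
    have hg₀ : g₀ ∈ compat r σ := by
      refine ⟨fun i j h => ?_, fun i j h => ?_⟩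
      · change resK r h (((g (j + 1) : Compat r σ) : Grp r σ).left.toAdd j) = ((g (i + 1) : Compat r σ) : Grp r σ).left.toAdd i
        rw [(g (j + 1)).2.1 i j h, (hcoord (Nat.lt_succ_of_le h)).1]
      · change resC h (((g (j + 1) : Compat r σ) : Grp r σ).right.1 j) = ((g (i + 1) : Compat r σ) : Grp r σ).right.1 i
        rw [(g (j + 1)).2.2 i j h, (hcoord (Nat.lt_succ_of_le h)).2]
    -- it represents `x` modulo every `vSub n` …
    have hglue : ∀ n, x (vOpenNormal r σ n) = ((⟨g₀, hg₀⟩ : Compat r σ) : Compat r σ ⧸ (vOpenNormal r σ n).toSubgroup) := by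
      intro n
      rw [← hg n]
      refine QuotientGroup.eq.2 ((inv_mul_mem_vSub_iff r σ n (g n) ⟨g₀, hg₀⟩).2 ⟨hγ n, fun i hi => ?_⟩)
      exact ⟨(hcoord hi).1, (hcoord hi).2⟩
    -- … hence modulo every open normal subgroup
    refine ⟨⟨g₀, hg₀⟩, fun N => ?_⟩
    obtain ⟨n, hn⟩ := exists_vOpenNormal_le r σ N
    exact hx (vOpenNormal r σ n) N hn _ (hglue n)

/-- **«GRP₃′» is tempered**: `IsTempered Compat₃'` (three classes, translations through the theta shear).
[cite: MochizukiSemiAnbd2006, Def 3.1 (i) p.33] -/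
theorem isTempered_compat₃' : IsTempered Compat₃' := isTemperedC 3 thetaShear

/-- **«GRP₂′» is tempered**: `IsTempered Compat₂'` (chain-only tower, both root classes twistable).
[cite: MochizukiSemiAnbd2006, Def 3.1 (i) p.33] -/
theorem isTempered_compat₂' : IsTempered Compat₂' := isTemperedC 2 chainShear

end TateTowerKummerTwistRShear

end Literature.AnabelianGeometry.EtaleTheta

end
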